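import Literature.NumberTheory.LFunctions.ThetaChainFreeCheck
import HarnessLib

/-!
# Schoenfeld's `θ`-bound on `[599, 10⁸]` by kernel computation: data-free run, chunk 9 of 35

Topic: `Literature/NumberTheory/LFunctions`. Pure proof file (a kernel computation; nothing is
asserted, no definition). The theorems below evaluate `ThetaChain.runFree` — together `150000`
data-free steps of the certified `θ`-chain (`ThetaChain.stepFree`, `ThetaChainFreeCheck.lean`: the
next prime found and certified by two gcds with the primorials of the odd primes `≤ 2999` and in
`(2999, 10007]`, the enclosures of `log p` and `θ(p)`, and the two comparisons behind
`|θ(x) − x| ≤ √x log² x/(8π)`) — from the state at the prime `28924979` to the state at the prime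
`31509139`. Soundness: `ThetaChain.runFree_sound`; assembly of the 35 chunks: `ThetaUpTo1e8.lean`.
The expected states were obtained by evaluating a twin of the same function outside the kernel
(validated bit-for-bit on the tree's chunk `ThetaChainRun.xrun14`). Declarations of `5·10⁴` steps
(about `70 s` of kernel time each; the kernel's evaluation is linear within a declaration of this size),
`decide +kernel`, standard axioms only (`maxHeartbeats 0` lifts the deterministic time-out).

## References

* L. Schoenfeld, *Sharper bounds for the Chebyshev functions θ(x) and ψ(x). II*, Math. Comp. 30
  (1976), 337–360, Thm. 10 (6.3). [Schoenfeld1976]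
* J. B. Rosser, L. Schoenfeld, *Approximate formulas for some functions of prime numbers*,
  Illinois J. Math. 6 (1962), 64–94, Thms. 18–19 (`θ`-tables to `10⁸`). [RosserSchoenfeld1962]
-/

namespace Literature.NumberTheory.LFunctions.ThetaChainRun

open ThetaChain

set_option maxHeartbeats 0 in
/-- **Data-free certified `θ`-run, chunk 9a** (steps `1200001`–`1250000` after `8886113`: 50000 primes,
`28924979` to `29786233`). [cite: Schoenfeld1976, Thm. 10 (6.3)] -/
theorem frun9a :
    runFree 50000
      ⟨28924979, 20769606835927424359443256, 20769606835927900003473683, 34961774250805977779939342810985, 34961774250806831690003315908224⟩ =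
    some ⟨29786233, 20805077638060387931708740, 20805077638060863576709672, 36001146322680540548679200718307, 36001146322681418240968969341831⟩ := by
  decide +kernel

set_option maxHeartbeats 0 in
/-- **Data-free certified `θ`-run, chunk 9b** (steps `1250001`–`1300000` after `8886113`: 50000 primes,
`29786233` to `30643891`). [cite: Schoenfeld1976, Thm. 10 (6.3)] -/
theorem frun9b :
    runFree 50000
      ⟨29786233, 20805077638060387931708740, 20805077638060863576709672, 36001146322680540548679200718307, 36001146322681418240968969341831⟩ =
    some ⟨30643891, 20839395440412799057067202, 20839395440413274703036644, 37042261074164340859209709399914, 37042261074165242333773736456053⟩ := by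
  decide +kernel

set_option maxHeartbeats 0 in
/-- **Data-free certified `θ`-run, chunk 9c** (steps `1300001`–`1350000` after `8886113`: 50000 primes,
`30643891` to `31509139`). [cite: Schoenfeld1976, Thm. 10 (6.3)] -/
theorem frun9c :
    runFree 50000
      ⟨30643891, 20839395440412799057067202, 20839395440413274703036644, 37042261074164340859209709399914, 37042261074165242333773736456053⟩ =
    some ⟨31509139, 20873057137318058689752092, 20873057137318534336688579, 38085074574694745116101921443816, 38085074574695670372988620573845⟩ := by
  decide +kernel

end Literature.NumberTheory.LFunctions.ThetaChainRun
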